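import Literature.MathematicalPhysics.QuantumFieldTheory.Balaban1983to89.T4ShellMeasureFibre
import Literature.MathematicalPhysics.QuantumFieldTheory.Balaban1983to89.T4SyncThresholds
import Summits.QuantumFields.BalabanUV.T4Continuum.Support.ShellMeasureRootComposition

/-!
# `T4Continuum.ShellMeasureRootCompositionSync` — NE7c ROOT COMPOSITION WITH SLOT-INDEXED THRESHOLDS: END-I re-typed so
# that the threshold of a slot is a function of the comparison index AND the slot (`θ K s`), not of END-I's level alone
# (`θ (lvl K s)`); design D8's synchronised AGE-indexed thresholds then instantiate it, which the level-indexed form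
# provably cannot host — kernel bookkeeping, no estimate (cell `pub-balaban`, sub-cell `t4`, spine estimate NE7c (node
# U5b); NE7c ROUND-2 crew seat `b2b-balaban-t4-ne7c-formalise-leaf-09` (gen 3), FINDING F-ne7cleaf09-3 + OFFERED row of
# `t4/b2b-balaban-t4-ne7c-p1/LEAVES-NE7c-P1.md` (the owner books ∕ renumbers ∕ refuses); ADDITIVE — imports END-I
# `ShellMeasureRootComposition` (p207618), `T4ShellMeasureFibre`, `T4SyncThresholds` only; 0 `def`, 0 sorry, 0 cite)

HONEST FRAMING.  Finite four-torus programme, rung (B)+1 only — NOT infinite volume, NOT a mass gap, NOT the Clay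
problem, NOT summit progress; (B), `BetaPertHyp`, (B^μ) are not consumed.  NE7c = `T4IndicatorShell.ShellWeightBound`
is NOT PRINTED in [Balaban 1983–89] and NOT PROVED; (M1) for Bałaban's effective measures is NOT PRINTED, asserted by
nobody and NOT moved here; every result below reads «NE7c ⇐ the named binders» (trigger c3).  HONEST DEPENDENCY
(cell): continuum YM on T⁴ ⇐ BetaPertH ∧ nine spine estimates (0/9 proved); BetaPertH ⇐ (D1) ∧ (D4) ∧ CAP+tail;
G-an2-4 gates asym, D1 and NE2/3/4.

THE FINDING (F-ne7cleaf09-3, type-level, on OUR composition END-I; every landed theorem is correct and untouched).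
END-I (`ShellMeasureRootComposition.levelLedger_of_slotAC` ∕ `shellWeightBound_of_slotAC`, hence rows S13, S19 f3, the
tower `…SeamTower`, the histories END and `LeafIndex` §1–§2) reads the THRESHOLD of slot `s` of comparison `K` as
`θ (lvl K s)` from ONE sequence `θ : ℕ → ℝ` shared by every `K`.  The cell's synchronisation design D8 (`t4/T4-DAG.md`
§1; `T4SyncThresholds`) makes every threshold of a run a function of the IR-ANCHORED AGE `n = K − level` through ONE
reference sequence `ḡ_n` (`oneLoopRef`), K-independent AS A FUNCTION OF THE AGE (the sibling ledger road types
thresholds per `(K, term, factor)` with a floor: `T4SupCloseLiaison.ThresholdFloor`, `θ : ℕ → ι → ℕ → ℝ`).  A level `j`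
is live at the `N₁ + 1` comparison indices `K = j, …, j + N₁` (`LiveWindow.recent`), i.e. at AGES `0, …, N₁`, so `θ j`
would have to equal `ε(ḡ_0), …, ε(ḡ_{N₁})` at once.  KERNEL (§0): level-indexed thresholds + D8 ⟹ equal design
thresholds at any two ages at which a level is populated (`ageSync_eq_of_levelIndexed`); for `ḡ = oneLoopRef b̄ g`,
`b̄ > 0`, and any injective profile `ε` the two ages coincide, so a window populated at every live level has depth
`N₁ = 0` (`window_depth_zero_of_levelIndexed_oneLoopRef`).  NOT a falsity of END-I — an instantiability obstruction
of the T-NE7c-4∕-6 kind: END-I as typed hosts the synchronised thresholds only in the degenerate constant case.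

THE REPAIR (free: `θ` does not occur in END-I's conclusion `LevelLedger` ∕ `ShellWeightBound`; it enters only the [dict]
push `piece_le` and the wall `hac`, and `T4ShellMeasure.slot_field_of_antiConcentration` is per slot with a free
threshold).  §1 END-I with `θ : ℕ → σ → ℝ` — `levelLedger_of_slotAC_sync`, `shellWeightBound_of_slotAC_sync`,
`hybridNE7_tail_of_slotAC_sync` (seam (ζ′) socket; road P2's `_band` head is the same one-line substitution, c6) — for
abstract slot spaces `Ω K s`, widths `ρ` and constants `D` still by level (node U1b's rate IS level-indexed; `D ≤ D̄`),
conclusions LITERALLY END-I's; §2 the realized tower form `shellWeightBound_of_towerData_sync` (slot `s` of comparison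
`K` on its own lattice `(P K s, j K s)`, any gauge group, finiteness discharged inside, slot→level majorants displayed);
§3 THE SYNCHRONISED READING `shellWeightBound_of_schemeData_age`: thresholds `ε (K − lvl K s)` by AGE along a cutoff
scheme `Psch : ℕ → Params` — the form §0 shows the level-indexed END-I cannot express; §4 END-I's level-indexed forms
recovered as the special case `θ K s := θ (lvl K s)` (nothing landed is lost).
WHAT THIS DOES NOT DO.  No estimate binder is discharged (SM-L1…L8 displayed); NODE O (the [dict] identification of
Bałaban's terms with these slot families) is constructed by nobody; (M1), NE7c NOT proved; spine 0/9.
-/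

open Finset MeasureTheory
open scoped ENNReal

namespace Summit.QuantumFields.BalabanUV.T4Continuum.ShellMeasureRootCompositionSync

open Literature.MathematicalPhysics.QuantumFieldTheory.Balaban1983to89
open T4WeightBudget T4IndicatorShell T4MatchingAssembly T4MatchingClosure T4MatchingClosureSocket
open T4ShellMeasure (SlotAntiConcentration slot_field_of_antiConcentration)
open T4ShellMeasureLevels (LevelLedger LiveWindow shellWeightBound_of_levels hybridNE7_tail_of_levels)
open T4ShellMeasureFibre (slotAntiConcentration_mono)
open T4SyncThresholds (oneLoopRef oneLoopRef_inv_sq)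

/-! ## §0 Kernel witness: level-indexed thresholds cannot host the age-synchronised design -/
section Obstruction
variable {σ : Type*} {S : ℕ → Finset σ} {lvl : ℕ → σ → ℕ}

/-- **THE OBSTRUCTION, abstract form.**  If the thresholds are read from ONE level sequence `θ : ℕ → ℝ` as
`θ (lvl K s)` (END-I's typing) AND obey the synchronisation design «the threshold of a live slot is a function `f` of
its IR-anchored AGE `K − lvl K s`» (D8), then a level `j` populated at the two comparison indices `j + a`, `j + b`
forces EQUAL design thresholds at the ages `a` and `b`. [folklore] -/
theorem ageSync_eq_of_levelIndexed {θ f : ℕ → ℝ} (hsync : ∀ K, ∀ s ∈ S K, θ (lvl K s) = f (K - lvl K s))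
    {j a b : ℕ} (ha : ∃ s ∈ S (j + a), lvl (j + a) s = j) (hb : ∃ s ∈ S (j + b), lvl (j + b) s = j) :
    f a = f b := by
  obtain ⟨⟨s, hs, hls⟩, s', hs', hls'⟩ := And.intro ha hb
  have h1 := hsync (j + a) s hs; have h2 := hsync (j + b) s' hs'
  rw [hls, Nat.add_sub_cancel_left] at h1; rw [hls', Nat.add_sub_cancel_left] at h2
  exact h1.symm.trans h2

/-- … hence, if some level is populated at EVERY age `a ≤ N₁` of the window, the design thresholds are CONSTANT on the
window's ages. [folklore] -/
theorem ageSync_const_of_levelIndexed {θ f : ℕ → ℝ} {N₁ : ℕ}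
    (hsync : ∀ K, ∀ s ∈ S K, θ (lvl K s) = f (K - lvl K s))
    (hfull : ∃ j, ∀ a ≤ N₁, ∃ s ∈ S (j + a), lvl (j + a) s = j) : ∀ a ≤ N₁, f a = f 0 := by
  obtain ⟨j, hj⟩ := hfull
  exact fun a ha => ageSync_eq_of_levelIndexed hsync (hj a ha) (hj 0 (Nat.zero_le _))

/-- The one-loop reference sequence `ḡ_n = √((1/g² + b̄ n)⁻¹)` of `T4SyncThresholds` is INJECTIVE in the age `n`
(`b̄ > 0`, `g > 0`): no two ages share a reference coupling. [folklore] -/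
theorem oneLoopRef_injective {bb g : ℝ} (hg : 0 < g) (hbb : 0 < bb) : Function.Injective (oneLoopRef bb g) := by
  intro a b h
  have h' : 1 / g ^ 2 + bb * (a : ℝ) = 1 / g ^ 2 + bb * (b : ℝ) := by
    rw [← oneLoopRef_inv_sq hg hbb.le a, ← oneLoopRef_inv_sq hg hbb.le b, h]
  exact_mod_cast (mul_left_cancel₀ hbb.ne' (add_left_cancel h') : (a : ℝ) = b)

/-- **THE OBSTRUCTION for D8's one-loop reference.**  Level-indexed thresholds synchronised as
`θ (lvl K s) = ε (ḡ_{K − lvl K s})`, `ḡ = oneLoopRef b̄ g` (`b̄, g > 0`), ANY injective profile `ε` (e.g. a strictly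
monotone `x ↦ A₀·x·p₀(x)`): a level populated at comparisons `j + a` and `j + b` forces `a = b`. [folklore] -/
theorem age_eq_of_levelIndexed_oneLoopRef {ε : ℝ → ℝ} (hε : Function.Injective ε) {bb g : ℝ} (hg : 0 < g)
    (hbb : 0 < bb) {θ : ℕ → ℝ} (hsync : ∀ K, ∀ s ∈ S K, θ (lvl K s) = ε (oneLoopRef bb g (K - lvl K s)))
    {j a b : ℕ} (ha : ∃ s ∈ S (j + a), lvl (j + a) s = j) (hb : ∃ s ∈ S (j + b), lvl (j + b) s = j) : a = b :=
  oneLoopRef_injective hg hbb (hε (ageSync_eq_of_levelIndexed (f := fun n => ε (oneLoopRef bb g n)) hsync ha hb))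

/-- … so a slot family populated at every live level (every level `j` carries a slot at each comparison index `j + a`,
`a ≤ N₁` — one characteristic function per cube per kind per live level) has window depth `N₁ = 0`. [folklore] -/
theorem window_depth_zero_of_levelIndexed_oneLoopRef {ε : ℝ → ℝ} (hε : Function.Injective ε) {bb g : ℝ}
    (hg : 0 < g) (hbb : 0 < bb) {θ : ℕ → ℝ} {N₁ : ℕ}
    (hsync : ∀ K, ∀ s ∈ S K, θ (lvl K s) = ε (oneLoopRef bb g (K - lvl K s)))
    (hpop : ∀ j, ∀ a ≤ N₁, ∃ s ∈ S (j + a), lvl (j + a) s = j) : N₁ = 0 :=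
  age_eq_of_levelIndexed_oneLoopRef hε hg hbb hsync (hpop 0 N₁ le_rfl) (hpop 0 0 (Nat.zero_le _))

end Obstruction

/-! ## §1 END-I with slot-indexed thresholds (abstract slot spaces) -/
section OneRun
variable {ι σ : Type*} {Ω : ℕ → σ → Type*} [∀ K s, MeasurableSpace (Ω K s)]
  {l₀ : ℝ} {T : ℕ → Finset ι} {A sh : ℕ → ℝ → ι → ℝ} {S : ℕ → Finset σ} {piece : ℕ → ℝ → σ → ι → ℝ}
  {lvl : ℕ → σ → ℕ} {μ : ∀ K : ℕ, ℝ → ∀ s : σ, Measure (Ω K s)} [∀ K t s, IsFiniteMeasure (μ K t s)]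
  {u : ∀ K : ℕ, ℝ → ∀ s : σ, Ω K s → ℝ} {θ : ℕ → σ → ℝ} {D ρ : ℕ → ℝ} {Dslot M : ℕ → ℝ → σ → ℝ}

omit [∀ K t s, IsFiniteMeasure (μ K t s)] in
/-- Seam fact (ii) with slot-indexed thresholds: (M1) per slot at threshold `θ K s` with SLOT constants and displayed
level majorants `Dslot K t s ≤ D (lvl K s)` ⟹ (M1) with the level constant (`slotAntiConcentration_mono`). [folklore] -/
theorem hac_of_slotConst_sync (hρ : ∀ j, 0 ≤ ρ j)
    (hDslot : ∀ K t, |t| ≤ l₀ → ∀ s ∈ S K, Dslot K t s ≤ D (lvl K s))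
    (hac : ∀ K t, |t| ≤ l₀ → ∀ s ∈ S K,
      SlotAntiConcentration (μ K t s) (u K t s) (θ K s) (ρ (lvl K s)) (Dslot K t s)) :
    ∀ K t, |t| ≤ l₀ → ∀ s ∈ S K, SlotAntiConcentration (μ K t s) (u K t s) (θ K s) (ρ (lvl K s)) (D (lvl K s)) :=
  fun K t ht s hs => slotAntiConcentration_mono (hρ _) (hDslot K t ht s hs) (hac K t ht s hs)

/-- **ONE RUN: THE LEVEL LEDGER FROM SLOT DATA AND (M1) PER SLOT, THRESHOLDS BY SLOT.**  Verbatim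
`ShellMeasureRootComposition.levelLedger_of_slotAC` except that the threshold of slot `s` of comparison `K` is `θ K s`
(`θ : ℕ → σ → ℝ`; e.g. `ε (ḡ_{K − lvl K s})` under D8) in the [dict] push `piece_le` and in the wall `hac`; widths
`ρ` and constants `D` by level.  CONCLUSION: LITERALLY `LevelLedger l₀ T A sh S piece lvl D ρ`. [folklore] -/
theorem levelLedger_of_slotAC_sync
    (sh_nonneg : ∀ K t, |t| ≤ l₀ → ∀ τ ∈ T K, 0 ≤ sh K t τ)
    (sh_le : ∀ K t, |t| ≤ l₀ → ∀ τ ∈ T K, sh K t τ ≤ A K t τ)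
    (cover : ∀ K t, |t| ≤ l₀ → ∀ τ ∈ T K, sh K t τ ≤ ∑ s ∈ S K, piece K t s τ)
    (hM : ∀ K t, |t| ≤ l₀ → ∀ s ∈ S K, 0 ≤ M K t s)
    (piece_le : ∀ K t, |t| ≤ l₀ → ∀ s ∈ S K, ∑ τ ∈ T K, piece K t s τ ≤ M K t s *
      (μ K t s {x | θ K s * (1 - ρ (lvl K s)) ≤ u K t s x ∧ u K t s x < θ K s}).toReal)
    (total_ge : ∀ K t, |t| ≤ l₀ → ∀ s ∈ S K, M K t s * (μ K t s Set.univ).toReal ≤ ∑ τ ∈ T K, A K t τ)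
    (hD : ∀ j, 0 ≤ D j) (hρ : ∀ j, 0 ≤ ρ j)
    (hac : ∀ K t, |t| ≤ l₀ → ∀ s ∈ S K,
      SlotAntiConcentration (μ K t s) (u K t s) (θ K s) (ρ (lvl K s)) (D (lvl K s))) :
    LevelLedger l₀ T A sh S piece lvl D ρ where
  sh_nonneg := sh_nonneg; sh_le := sh_le; cover := cover; D_nonneg := hD; ρ_nonneg := hρ
  slot K t ht s hs := slot_field_of_antiConcentration (hD _) (hρ _) (hac K t ht s hs) (T K) (hM K t ht s hs)
    (piece_le K t ht s hs) (total_ge K t ht s hs)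

/-- §4 NOTHING LANDED IS LOST: END-I's level-indexed ledger `ShellMeasureRootComposition.levelLedger_of_slotAC`
(thresholds `θ' (lvl K s)`) IS `levelLedger_of_slotAC_sync` at `θ K s := θ' (lvl K s)` — same binders, same
conclusion; likewise for the two-run END-I and its twins. [folklore] -/
example {θ' : ℕ → ℝ}
    (sh_nonneg : ∀ K t, |t| ≤ l₀ → ∀ τ ∈ T K, 0 ≤ sh K t τ)
    (sh_le : ∀ K t, |t| ≤ l₀ → ∀ τ ∈ T K, sh K t τ ≤ A K t τ)
    (cover : ∀ K t, |t| ≤ l₀ → ∀ τ ∈ T K, sh K t τ ≤ ∑ s ∈ S K, piece K t s τ)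
    (hM : ∀ K t, |t| ≤ l₀ → ∀ s ∈ S K, 0 ≤ M K t s)
    (piece_le : ∀ K t, |t| ≤ l₀ → ∀ s ∈ S K, ∑ τ ∈ T K, piece K t s τ ≤ M K t s *
      (μ K t s {x | θ' (lvl K s) * (1 - ρ (lvl K s)) ≤ u K t s x ∧ u K t s x < θ' (lvl K s)}).toReal)
    (total_ge : ∀ K t, |t| ≤ l₀ → ∀ s ∈ S K, M K t s * (μ K t s Set.univ).toReal ≤ ∑ τ ∈ T K, A K t τ)
    (hD : ∀ j, 0 ≤ D j) (hρ : ∀ j, 0 ≤ ρ j)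
    (hac : ∀ K t, |t| ≤ l₀ → ∀ s ∈ S K,
      SlotAntiConcentration (μ K t s) (u K t s) (θ' (lvl K s)) (ρ (lvl K s)) (D (lvl K s))) :
    LevelLedger l₀ T A sh S piece lvl D ρ :=
  levelLedger_of_slotAC_sync (θ := fun K s => θ' (lvl K s)) sh_nonneg sh_le cover hM piece_le total_ge hD hρ hac

end OneRun

section TwoRuns
variable {ι σ σ' : Type*} {ΩA : ℕ → σ → Type*} {ΩB : ℕ → σ' → Type*} [∀ K s, MeasurableSpace (ΩA K s)]
  [∀ K s, MeasurableSpace (ΩB K s)] {l₀ : ℝ} {T : ℕ → Finset ι} {A B shA shB : ℕ → ℝ → ι → ℝ}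
  {SA : ℕ → Finset σ} {SB : ℕ → Finset σ'} {pieceA : ℕ → ℝ → σ → ι → ℝ} {pieceB : ℕ → ℝ → σ' → ι → ℝ}
  {lvlA : ℕ → σ → ℕ} {lvlB : ℕ → σ' → ℕ}
  {μA : ∀ K : ℕ, ℝ → ∀ s : σ, Measure (ΩA K s)} [∀ K t s, IsFiniteMeasure (μA K t s)]
  {μB : ∀ K : ℕ, ℝ → ∀ s : σ', Measure (ΩB K s)} [∀ K t s, IsFiniteMeasure (μB K t s)]
  {uA : ∀ K : ℕ, ℝ → ∀ s : σ, ΩA K s → ℝ} {uB : ∀ K : ℕ, ℝ → ∀ s : σ', ΩB K s → ℝ}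
  {θA : ℕ → σ → ℝ} {θB : ℕ → σ' → ℝ} {DA ρA DB ρB : ℕ → ℝ} {MA : ℕ → ℝ → σ → ℝ} {MB : ℕ → ℝ → σ' → ℝ}
  {N₁ : ℕ} {νbar Dbar c₁ ϑ : ℝ}

/-- **END-I WITH SLOT-INDEXED THRESHOLDS — `ShellWeightBound` ⇐ THE NAMED BINDERS (trigger c1/c3).**  Verbatim
`ShellMeasureRootComposition.shellWeightBound_of_slotAC` with `θX K s` for `θX (lvlX K s)` (X ∈ {A, B}); (W1) windows
+ count (SM-L7), `D ≤ D̄`, rate `ρ_j ≤ c₁ϑ^j`, `0 < ϑ < 1` (SM-L8, node U1b BY NAME — no NE7c seat proves it, c4).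
CONCLUSION: LITERALLY `T4IndicatorShell.ShellWeightBound l₀ T A B shA shB Wsh` with END-I's
`Wsh K = Σ_{s∈S^A K} D^A_{lvl s}ρ^A_{lvl s} + Σ_{s∈S^B K} D^B_{lvl s}ρ^B_{lvl s}`.  CONDITIONAL on every binder; nothing
PRINTED is asserted. [folklore] -/
theorem shellWeightBound_of_slotAC_sync
    (sh_nonnegA : ∀ K t, |t| ≤ l₀ → ∀ τ ∈ T K, 0 ≤ shA K t τ)
    (sh_leA : ∀ K t, |t| ≤ l₀ → ∀ τ ∈ T K, shA K t τ ≤ A K t τ)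
    (coverA : ∀ K t, |t| ≤ l₀ → ∀ τ ∈ T K, shA K t τ ≤ ∑ s ∈ SA K, pieceA K t s τ)
    (hMA : ∀ K t, |t| ≤ l₀ → ∀ s ∈ SA K, 0 ≤ MA K t s)
    (piece_leA : ∀ K t, |t| ≤ l₀ → ∀ s ∈ SA K, ∑ τ ∈ T K, pieceA K t s τ ≤ MA K t s *
      (μA K t s {x | θA K s * (1 - ρA (lvlA K s)) ≤ uA K t s x ∧ uA K t s x < θA K s}).toReal)
    (total_geA : ∀ K t, |t| ≤ l₀ → ∀ s ∈ SA K, MA K t s * (μA K t s Set.univ).toReal ≤ ∑ τ ∈ T K, A K t τ)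
    (hDA0 : ∀ j, 0 ≤ DA j) (hρA0 : ∀ j, 0 ≤ ρA j)
    (hacA : ∀ K t, |t| ≤ l₀ → ∀ s ∈ SA K,
      SlotAntiConcentration (μA K t s) (uA K t s) (θA K s) (ρA (lvlA K s)) (DA (lvlA K s)))
    (sh_nonnegB : ∀ K t, |t| ≤ l₀ → ∀ τ ∈ T K, 0 ≤ shB K t τ)
    (sh_leB : ∀ K t, |t| ≤ l₀ → ∀ τ ∈ T K, shB K t τ ≤ B K t τ)
    (coverB : ∀ K t, |t| ≤ l₀ → ∀ τ ∈ T K, shB K t τ ≤ ∑ s ∈ SB K, pieceB K t s τ)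
    (hMB : ∀ K t, |t| ≤ l₀ → ∀ s ∈ SB K, 0 ≤ MB K t s)
    (piece_leB : ∀ K t, |t| ≤ l₀ → ∀ s ∈ SB K, ∑ τ ∈ T K, pieceB K t s τ ≤ MB K t s *
      (μB K t s {x | θB K s * (1 - ρB (lvlB K s)) ≤ uB K t s x ∧ uB K t s x < θB K s}).toReal)
    (total_geB : ∀ K t, |t| ≤ l₀ → ∀ s ∈ SB K, MB K t s * (μB K t s Set.univ).toReal ≤ ∑ τ ∈ T K, B K t τ)
    (hDB0 : ∀ j, 0 ≤ DB j) (hρB0 : ∀ j, 0 ≤ ρB j)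
    (hacB : ∀ K t, |t| ≤ l₀ → ∀ s ∈ SB K,
      SlotAntiConcentration (μB K t s) (uB K t s) (θB K s) (ρB (lvlB K s)) (DB (lvlB K s)))
    (hwA : LiveWindow SA lvlA N₁ νbar) (hwB : LiveWindow SB lvlB N₁ νbar) (hϑ0 : 0 < ϑ) (hϑ1 : ϑ < 1)
    (hDA : ∀ j, DA j ≤ Dbar) (hDB : ∀ j, DB j ≤ Dbar)
    (hrateA : ∀ j, ρA j ≤ c₁ * ϑ ^ j) (hrateB : ∀ j, ρB j ≤ c₁ * ϑ ^ j) :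
    ShellWeightBound l₀ T A B shA shB
      (fun K => ∑ s ∈ SA K, DA (lvlA K s) * ρA (lvlA K s) + ∑ s ∈ SB K, DB (lvlB K s) * ρB (lvlB K s)) :=
  shellWeightBound_of_levels
    (levelLedger_of_slotAC_sync sh_nonnegA sh_leA coverA hMA piece_leA total_geA hDA0 hρA0 hacA)
    (levelLedger_of_slotAC_sync sh_nonnegB sh_leB coverB hMB piece_leB total_geB hDB0 hρB0 hacB)
    hwA hwB hϑ0 hϑ1 hDA hDB hrateA hrateB

/-- **… THROUGH THE SEAM (ζ′) SOCKET.**  The binders of `shellWeightBound_of_slotAC_sync` PLUS the NE7b half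
`RelWeightBound`, a `ReindexedBudget` on the hybrid cores `A − shA`, `B − shB` and four summable producer rates ⇒
`∃ K₀`, `T4MatchingAssembly.HybridNE7` for the shifted families, shell weight END-I's `Wsh`, remainder rate
`(r + u) + (s + s₂)` (`T4ShellMeasureLevels.hybridNE7_tail_of_levels`). [folklore] -/
theorem hybridNE7_tail_of_slotAC_sync [DecidableEq ι] {vol : ℝ} {Bad : ℕ → ℝ → Finset ι}
    {Cc Rr CcRec RrRec : ℕ → ℝ → ι → ℝ} {ν u' s₂ c₀ r s' W : ℕ → ℝ}
    (sh_nonnegA : ∀ K t, |t| ≤ l₀ → ∀ τ ∈ T K, 0 ≤ shA K t τ)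
    (sh_leA : ∀ K t, |t| ≤ l₀ → ∀ τ ∈ T K, shA K t τ ≤ A K t τ)
    (coverA : ∀ K t, |t| ≤ l₀ → ∀ τ ∈ T K, shA K t τ ≤ ∑ s ∈ SA K, pieceA K t s τ)
    (hMA : ∀ K t, |t| ≤ l₀ → ∀ s ∈ SA K, 0 ≤ MA K t s)
    (piece_leA : ∀ K t, |t| ≤ l₀ → ∀ s ∈ SA K, ∑ τ ∈ T K, pieceA K t s τ ≤ MA K t s *
      (μA K t s {x | θA K s * (1 - ρA (lvlA K s)) ≤ uA K t s x ∧ uA K t s x < θA K s}).toReal)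
    (total_geA : ∀ K t, |t| ≤ l₀ → ∀ s ∈ SA K, MA K t s * (μA K t s Set.univ).toReal ≤ ∑ τ ∈ T K, A K t τ)
    (hDA0 : ∀ j, 0 ≤ DA j) (hρA0 : ∀ j, 0 ≤ ρA j)
    (hacA : ∀ K t, |t| ≤ l₀ → ∀ s ∈ SA K,
      SlotAntiConcentration (μA K t s) (uA K t s) (θA K s) (ρA (lvlA K s)) (DA (lvlA K s)))
    (sh_nonnegB : ∀ K t, |t| ≤ l₀ → ∀ τ ∈ T K, 0 ≤ shB K t τ)
    (sh_leB : ∀ K t, |t| ≤ l₀ → ∀ τ ∈ T K, shB K t τ ≤ B K t τ)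
    (coverB : ∀ K t, |t| ≤ l₀ → ∀ τ ∈ T K, shB K t τ ≤ ∑ s ∈ SB K, pieceB K t s τ)
    (hMB : ∀ K t, |t| ≤ l₀ → ∀ s ∈ SB K, 0 ≤ MB K t s)
    (piece_leB : ∀ K t, |t| ≤ l₀ → ∀ s ∈ SB K, ∑ τ ∈ T K, pieceB K t s τ ≤ MB K t s *
      (μB K t s {x | θB K s * (1 - ρB (lvlB K s)) ≤ uB K t s x ∧ uB K t s x < θB K s}).toReal)
    (total_geB : ∀ K t, |t| ≤ l₀ → ∀ s ∈ SB K, MB K t s * (μB K t s Set.univ).toReal ≤ ∑ τ ∈ T K, B K t τ)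
    (hDB0 : ∀ j, 0 ≤ DB j) (hρB0 : ∀ j, 0 ≤ ρB j)
    (hacB : ∀ K t, |t| ≤ l₀ → ∀ s ∈ SB K,
      SlotAntiConcentration (μB K t s) (uB K t s) (θB K s) (ρB (lvlB K s)) (DB (lvlB K s)))
    (hwA : LiveWindow SA lvlA N₁ νbar) (hwB : LiveWindow SB lvlB N₁ νbar) (hϑ0 : 0 < ϑ) (hϑ1 : ϑ < 1)
    (hDA : ∀ j, DA j ≤ Dbar) (hDB : ∀ j, DB j ≤ Dbar)
    (hrateA : ∀ j, ρA j ≤ c₁ * ϑ ^ j) (hrateB : ∀ j, ρB j ≤ c₁ * ϑ ^ j)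
    (hW : RelWeightBound l₀ T A B Bad W)
    (hTB : ReindexedBudget l₀ vol T (fun K t τ => A K t τ - shA K t τ) (fun K t τ => B K t τ - shB K t τ) Bad Cc Rr
      CcRec RrRec ν u' s₂ c₀ r s')
    (hr : Summable r) (hu : Summable u') (hs : Summable s') (hs₂ : Summable s₂) :
    ∃ K₀, HybridNE7 l₀ vol (fun K => T (K₀ + K)) (fun K => A (K₀ + K)) (fun K => B (K₀ + K)) (fun K => Bad (K₀ + K))
      (fun K => W (K₀ + K)) (fun K => shA (K₀ + K)) (fun K => shB (K₀ + K))
      (fun K => ∑ s ∈ SA (K₀ + K), DA (lvlA (K₀ + K) s) * ρA (lvlA (K₀ + K) s) +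
        ∑ s ∈ SB (K₀ + K), DB (lvlB (K₀ + K) s) * ρB (lvlB (K₀ + K) s))
      (fun K => (r (K₀ + K) + u' (K₀ + K)) + (s' (K₀ + K) + s₂ (K₀ + K))) :=
  hybridNE7_tail_of_levels
    (levelLedger_of_slotAC_sync sh_nonnegA sh_leA coverA hMA piece_leA total_geA hDA0 hρA0 hacA)
    (levelLedger_of_slotAC_sync sh_nonnegB sh_leB coverB hMB piece_leB total_geB hDB0 hρB0 hacB)
    hwA hwB hϑ0 hϑ1 hDA hDB hrateA hrateB hW hTB hr hu hs hs₂

end TwoRuns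

/-! ## §2 The realized tower with slot-indexed thresholds (any gauge group) -/

section Tower
variable {ι σ σ' : Type*} {G : Type*} [GaugeGroup G] [MeasurableSpace G] [HaarData G]
  {l₀ : ℝ} {T : ℕ → Finset ι} {A B shA shB : ℕ → ℝ → ι → ℝ}
  {SA : ℕ → Finset σ} {SB : ℕ → Finset σ'} {pieceA : ℕ → ℝ → σ → ι → ℝ} {pieceB : ℕ → ℝ → σ' → ι → ℝ}
  {lvlA : ℕ → σ → ℕ} {lvlB : ℕ → σ' → ℕ}
  {PA : ℕ → σ → Params} {jA : ℕ → σ → ℕ} {PB : ℕ → σ' → Params} {jB : ℕ → σ' → ℕ}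
  {FA : ∀ K : ℕ, ℝ → ∀ s : σ, GaugeField (PA K s) (jA K s) G → ℝ≥0∞}
  {FB : ∀ K : ℕ, ℝ → ∀ s : σ', GaugeField (PB K s) (jB K s) G → ℝ≥0∞}
  {uA : ∀ K : ℕ, ℝ → ∀ s : σ, GaugeField (PA K s) (jA K s) G → ℝ}
  {uB : ∀ K : ℕ, ℝ → ∀ s : σ', GaugeField (PB K s) (jB K s) G → ℝ}
  {θA : ℕ → σ → ℝ} {θB : ℕ → σ' → ℝ} {DA ρA DB ρB : ℕ → ℝ}
  {DslotA MA : ℕ → ℝ → σ → ℝ} {DslotB MB : ℕ → ℝ → σ' → ℝ} {N₁ : ℕ} {νbar Dbar c₁ ϑ : ℝ}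

/-- **END-I FOR TWO REALIZED SLOT FAMILIES ON THEIR TOWERS, THRESHOLDS BY SLOT.**  Verbatim
`ShellMeasureRootCompositionSeamTower.shellWeightBound_of_towerData` (slot `s` of comparison `K` of run X on its own
lattice `(PX K s, jX K s)`, realized measure `(fieldMeasure (PX K s) (jX K s) G).withDensity (FX K t s)`, the
`IsFiniteMeasure` instances DISCHARGED from `hFfinX`, (M1) per slot with SLOT constants and displayed majorants
`hDslotX`) except that the slot's threshold is `θX K s`.  CONCLUSION: LITERALLY END-I's `ShellWeightBound …` with END-I's
`Wsh`.  (The seam (ζ′) tail follows by the same one-line substitution in §1's twin.)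
CONDITIONAL on every binder; nothing PRINTED is asserted. [folklore] -/
theorem shellWeightBound_of_towerData_sync
    (hFfinA : ∀ K t s, ∫⁻ U, FA K t s U ∂(fieldMeasure (PA K s) (jA K s) G) ≠ ∞)
    (sh_nonnegA : ∀ K t, |t| ≤ l₀ → ∀ τ ∈ T K, 0 ≤ shA K t τ)
    (sh_leA : ∀ K t, |t| ≤ l₀ → ∀ τ ∈ T K, shA K t τ ≤ A K t τ)
    (coverA : ∀ K t, |t| ≤ l₀ → ∀ τ ∈ T K, shA K t τ ≤ ∑ s ∈ SA K, pieceA K t s τ)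
    (hMA : ∀ K t, |t| ≤ l₀ → ∀ s ∈ SA K, 0 ≤ MA K t s)
    (piece_leA : ∀ K t, |t| ≤ l₀ → ∀ s ∈ SA K, ∑ τ ∈ T K, pieceA K t s τ ≤ MA K t s *
      (((fieldMeasure (PA K s) (jA K s) G).withDensity (FA K t s))
        {x | θA K s * (1 - ρA (lvlA K s)) ≤ uA K t s x ∧ uA K t s x < θA K s}).toReal)
    (total_geA : ∀ K t, |t| ≤ l₀ → ∀ s ∈ SA K,
      MA K t s * (((fieldMeasure (PA K s) (jA K s) G).withDensity (FA K t s)) Set.univ).toReal ≤ ∑ τ ∈ T K, A K t τ)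
    (hDA0 : ∀ j, 0 ≤ DA j) (hρA0 : ∀ j, 0 ≤ ρA j)
    (hDslotA : ∀ K t, |t| ≤ l₀ → ∀ s ∈ SA K, DslotA K t s ≤ DA (lvlA K s))
    (hacA : ∀ K t, |t| ≤ l₀ → ∀ s ∈ SA K,
      SlotAntiConcentration ((fieldMeasure (PA K s) (jA K s) G).withDensity (FA K t s)) (uA K t s)
        (θA K s) (ρA (lvlA K s)) (DslotA K t s))
    (hFfinB : ∀ K t s, ∫⁻ U, FB K t s U ∂(fieldMeasure (PB K s) (jB K s) G) ≠ ∞)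
    (sh_nonnegB : ∀ K t, |t| ≤ l₀ → ∀ τ ∈ T K, 0 ≤ shB K t τ)
    (sh_leB : ∀ K t, |t| ≤ l₀ → ∀ τ ∈ T K, shB K t τ ≤ B K t τ)
    (coverB : ∀ K t, |t| ≤ l₀ → ∀ τ ∈ T K, shB K t τ ≤ ∑ s ∈ SB K, pieceB K t s τ)
    (hMB : ∀ K t, |t| ≤ l₀ → ∀ s ∈ SB K, 0 ≤ MB K t s)
    (piece_leB : ∀ K t, |t| ≤ l₀ → ∀ s ∈ SB K, ∑ τ ∈ T K, pieceB K t s τ ≤ MB K t s *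
      (((fieldMeasure (PB K s) (jB K s) G).withDensity (FB K t s))
        {x | θB K s * (1 - ρB (lvlB K s)) ≤ uB K t s x ∧ uB K t s x < θB K s}).toReal)
    (total_geB : ∀ K t, |t| ≤ l₀ → ∀ s ∈ SB K,
      MB K t s * (((fieldMeasure (PB K s) (jB K s) G).withDensity (FB K t s)) Set.univ).toReal ≤ ∑ τ ∈ T K, B K t τ)
    (hDB0 : ∀ j, 0 ≤ DB j) (hρB0 : ∀ j, 0 ≤ ρB j)
    (hDslotB : ∀ K t, |t| ≤ l₀ → ∀ s ∈ SB K, DslotB K t s ≤ DB (lvlB K s))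
    (hacB : ∀ K t, |t| ≤ l₀ → ∀ s ∈ SB K,
      SlotAntiConcentration ((fieldMeasure (PB K s) (jB K s) G).withDensity (FB K t s)) (uB K t s)
        (θB K s) (ρB (lvlB K s)) (DslotB K t s))
    (hwA : LiveWindow SA lvlA N₁ νbar) (hwB : LiveWindow SB lvlB N₁ νbar) (hϑ0 : 0 < ϑ) (hϑ1 : ϑ < 1)
    (hDA : ∀ j, DA j ≤ Dbar) (hDB : ∀ j, DB j ≤ Dbar)
    (hrateA : ∀ j, ρA j ≤ c₁ * ϑ ^ j) (hrateB : ∀ j, ρB j ≤ c₁ * ϑ ^ j) :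
    ShellWeightBound l₀ T A B shA shB
      (fun K => ∑ s ∈ SA K, DA (lvlA K s) * ρA (lvlA K s) + ∑ s ∈ SB K, DB (lvlB K s) * ρB (lvlB K s)) :=
  haveI : ∀ K t s, IsFiniteMeasure ((fieldMeasure (PA K s) (jA K s) G).withDensity (FA K t s)) :=
    fun K t s => isFiniteMeasure_withDensity (hFfinA K t s)
  haveI : ∀ K t s, IsFiniteMeasure ((fieldMeasure (PB K s) (jB K s) G).withDensity (FB K t s)) :=
    fun K t s => isFiniteMeasure_withDensity (hFfinB K t s)
  shellWeightBound_of_slotAC_sync (μA := fun K t s => (fieldMeasure (PA K s) (jA K s) G).withDensity (FA K t s))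
    (μB := fun K t s => (fieldMeasure (PB K s) (jB K s) G).withDensity (FB K t s))
    sh_nonnegA sh_leA coverA hMA piece_leA total_geA hDA0 hρA0
    (hac_of_slotConst_sync (μ := fun K t s => (fieldMeasure (PA K s) (jA K s) G).withDensity (FA K t s))
      hρA0 hDslotA hacA)
    sh_nonnegB sh_leB coverB hMB piece_leB total_geB hDB0 hρB0
    (hac_of_slotConst_sync (μ := fun K t s => (fieldMeasure (PB K s) (jB K s) G).withDensity (FB K t s))
      hρB0 hDslotB hacB)
    hwA hwB hϑ0 hϑ1 hDA hDB hrateA hrateB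

end Tower

/-! ## §3 The synchronised reading: thresholds by AGE along a cutoff scheme (D8 + node U1b's convention) -/

section Age
variable {ι σ σ' : Type*} {l₀ : ℝ} {T : ℕ → Finset ι} {G : Type*} [GaugeGroup G] [MeasurableSpace G] [HaarData G]
  {A B shA shB : ℕ → ℝ → ι → ℝ} {SA : ℕ → Finset σ} {SB : ℕ → Finset σ'}
  {pieceA : ℕ → ℝ → σ → ι → ℝ} {pieceB : ℕ → ℝ → σ' → ι → ℝ} {lvlA : ℕ → σ → ℕ} {lvlB : ℕ → σ' → ℕ}
  {Psch : ℕ → Params}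
  {FA : ∀ K : ℕ, ℝ → ∀ s : σ, GaugeField (Psch K) (lvlA K s) G → ℝ≥0∞}
  {FB : ∀ K : ℕ, ℝ → ∀ s : σ', GaugeField (Psch (K + 1)) (lvlB K s + 1) G → ℝ≥0∞}
  {uA : ∀ K : ℕ, ℝ → ∀ s : σ, GaugeField (Psch K) (lvlA K s) G → ℝ}
  {uB : ∀ K : ℕ, ℝ → ∀ s : σ', GaugeField (Psch (K + 1)) (lvlB K s + 1) G → ℝ}
  {εA εB : ℕ → ℝ} {DA ρA DB ρB : ℕ → ℝ} {DslotA MA : ℕ → ℝ → σ → ℝ} {DslotB MB : ℕ → ℝ → σ' → ℝ}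
  {N₁ : ℕ} {νbar Dbar c₁ ϑ : ℝ}

/-- **END-I FOR THE SYNCHRONISED DESIGN: THRESHOLDS BY AGE.**  Along a cutoff scheme `Psch : ℕ → Params` (run A = the
`K`-step run on `Psch K`, its slot of level `j` on `(Psch K, j)`; run B = the `(K+1)`-step run, its slot of level `j`
on `(Psch (K+1), j+1)` — node U1b's `ReadsLevels` convention, as in `…SeamTower.shellWeightBound_of_schemeData`), the
threshold of a slot is the design value at its IR-anchored AGE: `εX (K − lvlX K s)` (D8: `εX n = ε(ḡ_n)`,
K-independent in `n`; `εA = εB` in the synchronised comparison — not needed by the proof).  Binders and conclusion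
otherwise verbatim END-I's.  This is the instantiation §0 shows the level-indexed END-I cannot express. [folklore] -/
theorem shellWeightBound_of_schemeData_age
    (hFfinA : ∀ K t s, ∫⁻ U, FA K t s U ∂(fieldMeasure (Psch K) (lvlA K s) G) ≠ ∞)
    (sh_nonnegA : ∀ K t, |t| ≤ l₀ → ∀ τ ∈ T K, 0 ≤ shA K t τ)
    (sh_leA : ∀ K t, |t| ≤ l₀ → ∀ τ ∈ T K, shA K t τ ≤ A K t τ)
    (coverA : ∀ K t, |t| ≤ l₀ → ∀ τ ∈ T K, shA K t τ ≤ ∑ s ∈ SA K, pieceA K t s τ)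
    (hMA : ∀ K t, |t| ≤ l₀ → ∀ s ∈ SA K, 0 ≤ MA K t s)
    (piece_leA : ∀ K t, |t| ≤ l₀ → ∀ s ∈ SA K, ∑ τ ∈ T K, pieceA K t s τ ≤ MA K t s *
      (((fieldMeasure (Psch K) (lvlA K s) G).withDensity (FA K t s))
        {x | εA (K - lvlA K s) * (1 - ρA (lvlA K s)) ≤ uA K t s x ∧ uA K t s x < εA (K - lvlA K s)}).toReal)
    (total_geA : ∀ K t, |t| ≤ l₀ → ∀ s ∈ SA K,
      MA K t s * (((fieldMeasure (Psch K) (lvlA K s) G).withDensity (FA K t s)) Set.univ).toReal ≤ ∑ τ ∈ T K, A K t τ)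
    (hDA0 : ∀ j, 0 ≤ DA j) (hρA0 : ∀ j, 0 ≤ ρA j)
    (hDslotA : ∀ K t, |t| ≤ l₀ → ∀ s ∈ SA K, DslotA K t s ≤ DA (lvlA K s))
    (hacA : ∀ K t, |t| ≤ l₀ → ∀ s ∈ SA K,
      SlotAntiConcentration ((fieldMeasure (Psch K) (lvlA K s) G).withDensity (FA K t s)) (uA K t s)
        (εA (K - lvlA K s)) (ρA (lvlA K s)) (DslotA K t s))
    (hFfinB : ∀ K t s, ∫⁻ U, FB K t s U ∂(fieldMeasure (Psch (K + 1)) (lvlB K s + 1) G) ≠ ∞)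
    (sh_nonnegB : ∀ K t, |t| ≤ l₀ → ∀ τ ∈ T K, 0 ≤ shB K t τ)
    (sh_leB : ∀ K t, |t| ≤ l₀ → ∀ τ ∈ T K, shB K t τ ≤ B K t τ)
    (coverB : ∀ K t, |t| ≤ l₀ → ∀ τ ∈ T K, shB K t τ ≤ ∑ s ∈ SB K, pieceB K t s τ)
    (hMB : ∀ K t, |t| ≤ l₀ → ∀ s ∈ SB K, 0 ≤ MB K t s)
    (piece_leB : ∀ K t, |t| ≤ l₀ → ∀ s ∈ SB K, ∑ τ ∈ T K, pieceB K t s τ ≤ MB K t s *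
      (((fieldMeasure (Psch (K + 1)) (lvlB K s + 1) G).withDensity (FB K t s))
        {x | εB (K - lvlB K s) * (1 - ρB (lvlB K s)) ≤ uB K t s x ∧ uB K t s x < εB (K - lvlB K s)}).toReal)
    (total_geB : ∀ K t, |t| ≤ l₀ → ∀ s ∈ SB K,
      MB K t s * (((fieldMeasure (Psch (K + 1)) (lvlB K s + 1) G).withDensity (FB K t s)) Set.univ).toReal ≤
        ∑ τ ∈ T K, B K t τ)
    (hDB0 : ∀ j, 0 ≤ DB j) (hρB0 : ∀ j, 0 ≤ ρB j)
    (hDslotB : ∀ K t, |t| ≤ l₀ → ∀ s ∈ SB K, DslotB K t s ≤ DB (lvlB K s))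
    (hacB : ∀ K t, |t| ≤ l₀ → ∀ s ∈ SB K,
      SlotAntiConcentration ((fieldMeasure (Psch (K + 1)) (lvlB K s + 1) G).withDensity (FB K t s)) (uB K t s)
        (εB (K - lvlB K s)) (ρB (lvlB K s)) (DslotB K t s))
    (hwA : LiveWindow SA lvlA N₁ νbar) (hwB : LiveWindow SB lvlB N₁ νbar) (hϑ0 : 0 < ϑ) (hϑ1 : ϑ < 1)
    (hDA : ∀ j, DA j ≤ Dbar) (hDB : ∀ j, DB j ≤ Dbar)
    (hrateA : ∀ j, ρA j ≤ c₁ * ϑ ^ j) (hrateB : ∀ j, ρB j ≤ c₁ * ϑ ^ j) :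
    ShellWeightBound l₀ T A B shA shB
      (fun K => ∑ s ∈ SA K, DA (lvlA K s) * ρA (lvlA K s) + ∑ s ∈ SB K, DB (lvlB K s) * ρB (lvlB K s)) :=
  shellWeightBound_of_towerData_sync (PA := fun K _ => Psch K) (jA := lvlA) (PB := fun K _ => Psch (K + 1))
    (jB := fun K s => lvlB K s + 1) (θA := fun K s => εA (K - lvlA K s)) (θB := fun K s => εB (K - lvlB K s))
    hFfinA sh_nonnegA sh_leA coverA hMA piece_leA total_geA hDA0 hρA0 hDslotA hacA
    hFfinB sh_nonnegB sh_leB coverB hMB piece_leB total_geB hDB0 hρB0 hDslotB hacB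
    hwA hwB hϑ0 hϑ1 hDA hDB hrateA hrateB

end Age

end Summit.QuantumFields.BalabanUV.T4Continuum.ShellMeasureRootCompositionSync
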